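import Summits.QuantumFields.YangMills.Theorems.BalabanUVNodesN08PartialIteratesSufficiency
import Summits.QuantumFields.YangMills.Theorems.AlphaInputsT3ACBridge
import Literature.MathematicalPhysics.QuantumFieldTheory.Balaban1983to89.T4AvgSensitivity
import Literature.MathematicalPhysics.QuantumFieldTheory.Balaban1983to89.T4SeparableFibreExpansion
import HarnessLib

/-!
# R3 (cell `ym3-torus`, YM₃ on T³ — a ladder RUNG, NOT d = 4, NOT infinite volume, NOT a mass gap, NOT the Clay problem) —
# **R-19936-S: THE LINEAR MASS ENVELOPE FROM THE TOP LEVEL ALONE — every a.e. mass of the v1 tower at the run's top level `K` is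
# `≤ (K+1)·e^{c}` as soon as the partial iterated push-forwards of Haar ENDING AT THE UNIT TORUS are `≤ e^{c}·Haar`; no bound at the
# volume-growing intermediate levels is consumed**

Width seat `ym-ust-19936-w3` g19 on crux `stmt-QuantumFields-19936` `UnitScaleTilt.HistoryTailL` (`--supports`, helper; THEOREMS ONLY, 0 `def`,
0 `sorry`).  Companion of LEAD `ym-ust-19936-w1` g11's K-21 `UV3PinnedStepOrganOfPartialIterates` (the (S-ii) organ row `hSii` from a mass envelope LINEAR
in the run length, and that envelope from the all-levels letter (a)′∀) and of the pub-ymgap N08 files 17 ∕ 27 ∕ 30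
(`BalabanUVNodesN08MassesACLeastClosedFamily`, `…PartialIteratesSufficiency`, `…PartialIteratesNecessity`).

THE POINT.  In the v1 currency the history masses are the exact Radon–Nikodym transports `MassesAC.massRecAC` along the family's block averaging
`avT3 F K` (= `blockAvg ℰp` in range), floored at the trivial history.  File 27's sufficiency theorem
(`massRecAC_le_exp_mul_ae_of_partialIterates_le`) and, after it, K-21's displayed row (a)′∀ ask the partial iterated push-forwards of Haar
`ι_{j,k} = (Ū_{k−1}∘⋯∘Ū_j)_*dU_j` to be `≤ e^{c}·dU_k` at EVERY target level `j < k ≤ K` with ONE constant `c` per family.  But at an intermediate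
level `k < K` of the run `K` the lattice has `(2L^{m+K−k})³` sites (`T3ContinuumYM3Torus.T3Family.P`; only the top level `k = K` is the unit torus,
`2L^m` sites per direction, for EVERY run), and the expected shape of such bounds is VOLUME-EXTENSIVE, `e^{c_m·|T^{(k)}|}` ([Balaban1985UV3] Thm 1 (5):
bounds extensive in the current lattice; file 25's header) — a `K`-uniform constant at the volume-growing levels is not to be expected of a local,
not-Haar-exact averaging.  THIS FILE shows that NOTHING BELOW THE TARGET LEVEL IS CONSUMED: file 17's weak-closure domination
`m_k(h,·)·dU_k ≤ dU_k + ν_k` holds for the family `ν_k := Σ_{j<k} ι_{j,k}` from CLOSURE ALONE (it is closed with equality; the floor `max 1 (T[…])` is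
handled there by `withDensity_sup_le`), and the density bound is then spent at the target level only.  Hence (§1) `ι_{j,k} ≤ C·dU_k` for `j < k`, AT THE
ONE LEVEL `k`, already gives `m_k(h,·) ≤ 1 + k·C` a.e. for EVERY history; (§2) the ι-family IS the push-forward along the composite averaging
`T4AvgSensitivity.iterFrom av j n = Ū_{j+n−1}∘⋯∘Ū_j` (lit [Balaban1987RG1] (0.11)), so the hypothesis reads as ONE measure inequality per segment,
`(dU_j)∘(Ū_{k−1}∘⋯∘Ū_j)⁻¹ ≤ e^{c}·dU_k`, no auxiliary family; (§3) at the lane: the LINEAR envelope «`m_K(r,·) ≤ (K+1)·e^{A₁}` a.e.» — K-21 §2's binder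
`hJ` VERBATIM, and for every history — from the TOP-LEVEL letter

  hTop(F) : `∃ c ≥ 0, ∀ K j n, j + n = K → (dU_j^{(K)})∘(iterFrom (avT3 F K) j n)⁻¹ ≤ e^{c}·dU_{j+n}^{(K)}`

(«every segment of the family's block averaging ENDING AT THE UNIT TORUS pushes Haar to at most `e^{c}`·Haar»), which K-21's (a)′∀ implies (§3
`topHaarPushforward_of_partialIterates`) and which asks nothing at the levels whose volume grows with `K`.  With K-21 §2 (`hSii_of_linMassEnvelope`, by
name, once in the tree) the S organ of `stub_pinnedStep` therefore displays, beyond the (α) socket and `hMain`, ONLY hTop.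

CONTENTS.
* §1 (generic `P`, `G`, any averaging family with `AvgAC`) `map_add_sum_partialIterates` (the family `Σ_{j<k} ι_{j,k}` is closed with equality),
  `withDensity_massRecAC_le_sum_partialIterates` (`m_k(h,·)·dU_k ≤ Σ_{j≤k} ι_{j,k}`, NO density hypothesis), ★★ `massRecAC_le_ae_of_partialIterates_le_top`
  (`ι_{j,k} ≤ C·dU_k` for `j < k` at the target level only ⇒ `m_k(h,·) ≤ 1 + k·C` a.e.), ★ `massRecAC_le_lin_exp_ae_of_partialIterates_le_top` (`≤ (k+1)·e^{c}`).
* §2 (generic) ★ `partialIterates_eq_map_iterFrom` (`ι_{j,j+n} = (dU_j)∘(iterFrom av j n)⁻¹`),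
  ★★ `massRecAC_le_lin_exp_ae_of_map_iterFrom_le` (the top-level letter in `iterFrom` currency ⇒ `m_k(h,·) ≤ (k+1)·e^{c}` a.e., every history).
* §3 (the lane, per family `F`, record `𝔠`, socket `h : Of F 𝔠`, coupling in the window) ★★★ `AlphaInputsT3AC.Of.linMassEnvelope_all_of_topHaarPushforward`
  (EVERY history, incl. `triv`), ★★★ `AlphaInputsT3AC.Of.linMassEnvelope_of_topHaarPushforward` (K-21 §2's binder VERBATIM),
  ★ `AlphaInputsT3AC.Of.growingMassEnvelope_of_topHaarPushforward` (the `exp(A₁ + A₂·K)` reading, `A₂ = 1`), `iterFrom_avT3_eq_iterFrom_blockAvg` +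
  ★ `AlphaInputsT3AC.Of.linMassEnvelope_of_topBlockAvgPushforward` (the same with the cruxes' `blockAvg ℰp` family spelled out),
  ★ `topHaarPushforward_of_partialIterates` (K-21's (a)′∀ letter ⇒ hTop).

HONEST SCOPE.  Bookkeeping ([folklore] measure theory) over landed theorems; hTop is DISPLAYED (a hypothesis), NOT proved — for the tree's `blockAvg ℰp`
it is OPEN (the one-step image law is not Haar, lit `AveragingImageLawGaugeInvariance`); (a)′∀ is neither proved nor refuted here (the volume remark
above locates why the top-level letter is the one to display; it is not a theorem of this file); nothing of `hSii`, `hlf`, `stub_pinnedStep`,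
`stub_unitEnvelope`, `hP′`, `HistoryTailL` (19936), the rung `YM3TorusSU2`, any continuum limit, d = 4, a mass gap or Clay is proved here.  YM₃ on T³ is
rung R3 of the ladder, not the Clay problem.

References: T. Bałaban, Commun. Math. Phys. **102** (1985) 255–275 [Balaban1985UV3] ((41) p. 266, (47) p. 267, (2) p. 256, (5) p. 257);
T. Bałaban, Commun. Math. Phys. **98** (1985) 17–51 [Balaban1985Averaging] ((10), (15) p. 19); T. Bałaban, Commun. Math. Phys. **109** (1987) 249–301
[Balaban1987RG1] ((0.11) p. 253, the iterated averagings).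
-/

set_option autoImplicit false

noncomputable section

open MeasureTheory
open scoped ENNReal BigOperators

namespace Summit.QuantumFields.YangMills.Theorems.UV3PinnedStepOrganOfTopPartialIterates

open Literature.MathematicalPhysics.QuantumFieldTheory.Balaban1983to89
open Literature.MathematicalPhysics.QuantumFieldTheory.Balaban1983to89.T4AvgSensitivity (iterFrom)
open Literature.MathematicalPhysics.QuantumFieldTheory.Balaban1983to89.T4SeparableFibreExpansion (measurable_iterFrom)
open Summit.QuantumFields.Balaban3D.Carriers
open Summit.QuantumFields.Balaban3D.Proofs.MassesAC
open Summit.QuantumFields.YangMills.BalabanUVNodes.N08MassesACDominated (rnDeriv_le_of_le_withDensity)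
open Summit.QuantumFields.YangMills.BalabanUVNodes.N08MassesACLeastClosedFamily (withDensity_massRecAC_le_of_weakClosed)
open Summit.QuantumFields.YangMills.BalabanUVNodes.N08PartialIteratesSufficiency (map_finset_sum exists_partialIterates)

/-! ## §1 Sufficiency from the target level alone -/
section Top

variable {P : Params} {G : Type} [GaugeGroup G] [MeasurableSpace G] [HaarData G]
  (M₁ : ℕ) (Rcol : ℕ → ℕ) (εL εS : ℕ → ℝ) (av : ∀ j, Averaging P j G) (hav : ∀ j, AvgAC (av j).avg)
include hav

omit M₁ Rcol εL εS in
/-- **THE FAMILY `Σ_{j<k} ι_{j,k}` IS CLOSED WITH EQUALITY**: `(dU_k + Σ_{j<k} ι_{j,k})∘Ū_k⁻¹ = Σ_{j<k+1} ι_{j,k+1}` for every family of partial iterates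
(`ι_{j,j} = dU_j`, `ι_{j,k+1} = ι_{j,k}∘Ū_k⁻¹`, file 27's hypotheses) — the step inside file 27's proof, displayed. [cite: Balaban1985UV3, (2) p.256 (bookkeeping)] -/
theorem map_add_sum_partialIterates (ι : ∀ j k : ℕ, Measure (GaugeField P k G)) (hι0 : ∀ j, ι j j = fieldMeasure P j G)
    (hιs : ∀ j k, j ≤ k → ι j (k + 1) = (ι j k).map (av k).avg) (k : ℕ) :
    (fieldMeasure P k G + ∑ j ∈ Finset.range k, ι j k).map (av k).avg = ∑ j ∈ Finset.range (k + 1), ι j (k + 1) := by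
  rw [← hι0 k, ← Finset.sum_range_succ_comm (fun j => ι j k) k, map_finset_sum (hav k).1]
  refine Finset.sum_congr rfl fun j hj => ?_
  rw [hιs j k (by simpa [Nat.lt_succ_iff] using Finset.mem_range.1 hj)]

/-- **THE MEASURE FORM, WITH NO DENSITY HYPOTHESIS: `m_k(h,·)·dU_k ≤ Σ_{j≤k} ι_{j,k} = dU_k + Σ_{j<k} ι_{j,k}`** for every level `k` and EVERY history `h`
(file 17's ✓`withDensity_massRecAC_le_of_weakClosed` at the closed family `Σ_{j<k} ι_{j,k}`; the floor of the trivial history is handled there).  The iterated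
AC masses of (41) are dominated, as measures, by the sum of the partial iterated push-forwards of Haar — whatever their densities are below level `k`.
[cite: Balaban1985UV3, (41) p.266 + (47) p.267 + (2) p.256 (bookkeeping); Balaban1985Averaging, (10) p.19] -/
theorem withDensity_massRecAC_le_sum_partialIterates (ι : ∀ j k : ℕ, Measure (GaugeField P k G)) (hι0 : ∀ j, ι j j = fieldMeasure P j G)
    (hιs : ∀ j k, j ≤ k → ι j (k + 1) = (ι j k).map (av k).avg) (k : ℕ) (h : Hist P k) :
    (fieldMeasure P k G).withDensity (fun V => ENNReal.ofReal (massRecAC M₁ Rcol εL εS av k h V)) ≤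
      fieldMeasure P k G + ∑ j ∈ Finset.range k, ι j k :=
  withDensity_massRecAC_le_of_weakClosed M₁ Rcol εL εS av hav k (fun i => ∑ j ∈ Finset.range i, ι j i)
    (fun i _ => by rw [map_add_sum_partialIterates av hav ι hι0 hιs i]; exact Measure.le_add_left le_rfl) k le_rfl h

/-- ★★ **SUFFICIENCY FROM THE TARGET LEVEL ALONE**: if the partial iterated push-forwards of Haar INTO LEVEL `k` obey `ι_{j,k} ≤ C·dU_k` for all `j < k`
(`C ≥ 0`; NOTHING is asked at the levels below `k`), then **`m_k(h,V) ≤ 1 + k·C` for `dU_k`-a.e. `V`, EVERY history `h`** — file 27's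
`massRecAC_le_ae_of_partialIterates_le` with its hypothesis restricted to the one level the masses are read at (`withDensity_massRecAC_le_sum_partialIterates`,
then the Radon–Nikodym comparison of file 16). [cite: Balaban1985UV3, (41) p.266 + (2) p.256 + (5) p.257 (the extensive shape; bookkeeping); Balaban1985Averaging, (15) p.19] -/
theorem massRecAC_le_ae_of_partialIterates_le_top (ι : ∀ j k : ℕ, Measure (GaugeField P k G)) (hι0 : ∀ j, ι j j = fieldMeasure P j G)
    (hιs : ∀ j k, j ≤ k → ι j (k + 1) = (ι j k).map (av k).avg) (k : ℕ) (C : ℝ) (hC : 0 ≤ C)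
    (hbound : ∀ j, j < k → ι j k ≤ ENNReal.ofReal C • fieldMeasure P k G) (h : Hist P k) :
    ∀ᵐ V ∂(fieldMeasure P k G), massRecAC M₁ Rcol εL εS av k h V ≤ 1 + k * C := by
  have hmeas : Measurable fun V => ENNReal.ofReal (massRecAC M₁ Rcol εL εS av k h V) :=
    (measurable_massRecAC M₁ Rcol εL εS av k h).ennreal_ofReal
  have hkC : (0 : ℝ) ≤ k * C := mul_nonneg (Nat.cast_nonneg k) hC
  have hν : ∑ j ∈ Finset.range k, ι j k ≤ ENNReal.ofReal (k * C) • fieldMeasure P k G := by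
    calc ∑ j ∈ Finset.range k, ι j k ≤ ∑ j ∈ Finset.range k, ENNReal.ofReal C • fieldMeasure P k G :=
          Finset.sum_le_sum fun j hj => hbound j (Finset.mem_range.1 hj)
      _ = ENNReal.ofReal (k * C) • fieldMeasure P k G := by
          rw [Finset.sum_const, Finset.card_range, ← Nat.cast_smul_eq_nsmul ℝ≥0∞, smul_smul,
            ENNReal.ofReal_mul (Nat.cast_nonneg k), ENNReal.ofReal_natCast]
  have hle : (fieldMeasure P k G).withDensity (fun V => ENNReal.ofReal (massRecAC M₁ Rcol εL εS av k h V)) ≤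
      (fieldMeasure P k G).withDensity (fun _ => ENNReal.ofReal (1 + k * C)) := by
    calc (fieldMeasure P k G).withDensity (fun V => ENNReal.ofReal (massRecAC M₁ Rcol εL εS av k h V))
        ≤ fieldMeasure P k G + ∑ j ∈ Finset.range k, ι j k := withDensity_massRecAC_le_sum_partialIterates M₁ Rcol εL εS av hav ι hι0 hιs k h
      _ ≤ fieldMeasure P k G + ENNReal.ofReal (k * C) • fieldMeasure P k G := add_le_add le_rfl hν
      _ = (fieldMeasure P k G).withDensity (fun _ => ENNReal.ofReal (1 + k * C)) := by
          rw [withDensity_const, ENNReal.ofReal_add zero_le_one hkC, ENNReal.ofReal_one, add_smul, one_smul]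
  have h1 := rnDeriv_le_of_le_withDensity hle
  have h2 := Measure.rnDeriv_withDensity (fieldMeasure P k G) hmeas
  filter_upwards [h1, h2] with V hV1 hV2
  have h3 : ENNReal.ofReal (massRecAC M₁ Rcol εL εS av k h V) ≤ ENNReal.ofReal (1 + k * C) := by rw [← hV2]; exact hV1
  exact (ENNReal.ofReal_le_ofReal_iff (by linarith)).1 h3

/-- ★ **… in the exponential shape**: `ι_{j,k} ≤ e^{c}·dU_k` for `j < k` (target level only, `c ≥ 0`) ⇒ `m_k(h,V) ≤ (k+1)·e^{c}` for `dU_k`-a.e. `V`, every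
history — file 27's `massRecAC_le_exp_mul_ae_of_partialIterates_le` with the top-level hypothesis. [cite: Balaban1985UV3, (41) p.266 + (5) p.257 (bookkeeping)] -/
theorem massRecAC_le_lin_exp_ae_of_partialIterates_le_top (ι : ∀ j k : ℕ, Measure (GaugeField P k G)) (hι0 : ∀ j, ι j j = fieldMeasure P j G)
    (hιs : ∀ j k, j ≤ k → ι j (k + 1) = (ι j k).map (av k).avg) (k : ℕ) (c : ℝ) (hc : 0 ≤ c)
    (hbound : ∀ j, j < k → ι j k ≤ ENNReal.ofReal (Real.exp c) • fieldMeasure P k G) (h : Hist P k) :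
    ∀ᵐ V ∂(fieldMeasure P k G), massRecAC M₁ Rcol εL εS av k h V ≤ ((k : ℝ) + 1) * Real.exp c := by
  filter_upwards [massRecAC_le_ae_of_partialIterates_le_top M₁ Rcol εL εS av hav ι hι0 hιs k (Real.exp c) (Real.exp_pos c).le hbound h]
    with V hV
  have h1 : (1 : ℝ) ≤ Real.exp c := Real.one_le_exp hc
  linarith

/-! ## §2 The partial iterates are the push-forwards along the composite averaging `iterFrom` -/

omit M₁ Rcol εL εS in
/-- ★ **THE PARTIAL ITERATES ARE THE PUSH-FORWARDS OF HAAR ALONG THE COMPOSITE AVERAGING: `ι_{j,j+n} = (dU_j)∘(Ū_{j+n−1}∘⋯∘Ū_j)⁻¹`** for every family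
`ι` with file 27's recursion (`ι_{j,j} = dU_j`, `ι_{j,k+1} = ι_{j,k}∘Ū_k⁻¹`), the composite being lit `T4AvgSensitivity.iterFrom av j n` ([Balaban1987RG1] (0.11));
induction on `n`, `Measure.map_map`, lit `T4SeparableFibreExpansion.measurable_iterFrom`. [cite: Balaban1987RG1, (0.11) p.253; Balaban1985UV3, (2) p.256 (bookkeeping)] -/
theorem partialIterates_eq_map_iterFrom (ι : ∀ j k : ℕ, Measure (GaugeField P k G)) (hι0 : ∀ j, ι j j = fieldMeasure P j G)
    (hιs : ∀ j k, j ≤ k → ι j (k + 1) = (ι j k).map (av k).avg) (j : ℕ) :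
    ∀ n : ℕ, ι j (j + n) = (fieldMeasure P j G).map (iterFrom av j n)
  | 0 => by
    show ι j j = (fieldMeasure P j G).map id
    rw [Measure.map_id, hι0]
  | n + 1 => by
    show ι j (j + n + 1) = (fieldMeasure P j G).map ((av (j + n)).avg ∘ iterFrom av j n)
    rw [hιs j (j + n) (Nat.le_add_right j n), partialIterates_eq_map_iterFrom ι hι0 hιs j n,
      Measure.map_map (hav (j + n)).1 (measurable_iterFrom av (fun i => (hav i).1) j n)]

/-- ★★ **THE TOP-LEVEL LETTER IN PUSH-FORWARD CURRENCY ⇒ THE LINEAR ENVELOPE, EVERY HISTORY**: if every segment of the averaging ENDING AT LEVEL `k`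
pushes Haar to at most `e^{c}`·Haar, `(dU_j)∘(iterFrom av j n)⁻¹ ≤ e^{c}·dU_{j+n}` whenever `j + n = k` (`c ≥ 0`; ONE measure inequality per segment, no
auxiliary family, nothing at the other levels), then `m_k(h,V) ≤ (k+1)·e^{c}` for `dU_k`-a.e. `V` and every history `h` (§1 + `partialIterates_eq_map_iterFrom`
at the canonical family of file 27's `exists_partialIterates`). [cite: Balaban1985UV3, (41) p.266 + (2) p.256 + (5) p.257 (bookkeeping); Balaban1985Averaging, (15) p.19] -/
theorem massRecAC_le_lin_exp_ae_of_map_iterFrom_le (k : ℕ) (c : ℝ) (hc : 0 ≤ c)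
    (hbound : ∀ j n : ℕ, j + n = k →
      (fieldMeasure P j G).map (iterFrom av j n) ≤ ENNReal.ofReal (Real.exp c) • fieldMeasure P (j + n) G)
    (h : Hist P k) :
    ∀ᵐ V ∂(fieldMeasure P k G), massRecAC M₁ Rcol εL εS av k h V ≤ ((k : ℝ) + 1) * Real.exp c := by
  obtain ⟨ι, hι0, hιs⟩ := exists_partialIterates av
  refine massRecAC_le_lin_exp_ae_of_partialIterates_le_top M₁ Rcol εL εS av hav ι hι0 hιs k c hc (fun j hj => ?_) h
  obtain ⟨n, rfl⟩ : ∃ n, k = j + n := ⟨k - j, by omega⟩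
  rw [partialIterates_eq_map_iterFrom av hav ι hι0 hιs j n]
  exact hbound j n rfl

omit M₁ Rcol εL εS in
/-- **The all-levels letter implies the top-level letter in push-forward currency** (generic form): if, for some family of partial iterates, `ι_{j,k′} ≤ e^{c}·dU_{k′}`
for all `j < k′ ≤ k` (`c ≥ 0`), then every segment ending at level `k` pushes Haar to `≤ e^{c}`·Haar (`n = 0`: `dU_j ≤ e^{c}·dU_j` as `1 ≤ e^{c}`).
[cite: Balaban1985UV3, (2) p.256 (bookkeeping); Balaban1987RG1, (0.11) p.253] -/
theorem map_iterFrom_le_of_partialIterates_le (ι : ∀ j k : ℕ, Measure (GaugeField P k G)) (hι0 : ∀ j, ι j j = fieldMeasure P j G)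
    (hιs : ∀ j k, j ≤ k → ι j (k + 1) = (ι j k).map (av k).avg) (k : ℕ) (c : ℝ) (hc : 0 ≤ c)
    (hbound : ∀ j k', j < k' → k' ≤ k → ι j k' ≤ ENNReal.ofReal (Real.exp c) • fieldMeasure P k' G)
    (j n : ℕ) (hjn : j + n = k) :
    (fieldMeasure P j G).map (iterFrom av j n) ≤ ENNReal.ofReal (Real.exp c) • fieldMeasure P (j + n) G := by
  rw [← partialIterates_eq_map_iterFrom av hav ι hι0 hιs j n]
  rcases Nat.eq_zero_or_pos n with hn | hn
  · subst hn
    show ι j j ≤ ENNReal.ofReal (Real.exp c) • fieldMeasure P j G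
    rw [hι0]
    have h1 : (1 : ℝ≥0∞) ≤ ENNReal.ofReal (Real.exp c) := by
      rw [← ENNReal.ofReal_one]; exact ENNReal.ofReal_le_ofReal (Real.one_le_exp hc)
    refine Measure.le_iff.2 fun s _ => ?_
    rw [Measure.smul_apply, smul_eq_mul]
    exact le_mul_of_one_le_left bot_le h1
  · exact hbound j (j + n) (by omega) (by omega)

end Top

/-! ## §3 At the lane: the linear mass envelope of the v1 tower from the top-level letter for the family's block averaging -/
section Lane

open Literature.MathematicalPhysics.QuantumFieldTheory.Balaban1983to89.T3ContinuumYM3Torus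
open Literature.MathematicalPhysics.QuantumFieldTheory.Balaban1983to89.T3UnitLawDensityEML (ℰp)
open Literature.MathematicalPhysics.QuantumFieldTheory.Balaban1985CMP102
open Literature.MathematicalPhysics.QuantumFieldTheory.Balaban1985CMP102.Setting
open Summit.QuantumFields.Balaban3D.Proofs.Primitives
open Summit.QuantumFields.Balaban3D.Proofs.TowerAC
open Summit.QuantumFields.Balaban3D.Proofs.StandardAC
open Summit.QuantumFields.Balaban3D.Proofs.InputsAC

variable {F : T3Family} {𝔠 : AlphaConsts F.L (suGroupModel 2).N}

/-- ★★★ **THE LINEAR MASS ENVELOPE FOR EVERY HISTORY FROM THE TOP-LEVEL LETTER hTop.**  Per family `F`, record `𝔠`, socket `h : Of F 𝔠`, coupling `γ` in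
the window: IF (hTop) there is `c ≥ 0` such that at every run `K` every segment of the family's pinned block averaging `avT3 F K` (= `blockAvg ℰp` in
range, ✓`avT3_of_le`) ENDING AT THE UNIT TORUS pushes Haar to at most `e^{c}`·Haar — `(dU_j)∘(iterFrom (avT3 F K) j n)⁻¹ ≤ e^{c}·dU_{j+n}` for `j + n = K`
— THEN the lane's masses of the package's data obey `m_K(r,·) ≤ (K+1)·e^{c}` `dV_K`-a.e. for EVERY run `K` and EVERY history `r` (the package's averaging
IS `avT3 F K` and its masses ARE `massRecAC`, both `rfl`, as in K-21 §3; §2 at ✓`avgAC_avT3`).  Nothing is asked of the push-forwards into the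
volume-growing levels `k < K`. [cite: Balaban1985UV3, (41) p.266 + (2) p.256 + (5) p.257; Balaban1985Averaging, (15) p.19; Balaban1987RG1, (0.11) p.253] -/
theorem _root_.Summit.QuantumFields.YangMills.Theorems.AlphaInputsT3AC.Of.linMassEnvelope_all_of_topHaarPushforward
    (h : AlphaInputsT3AC.Of F 𝔠) (γ : ℝ) (hγ : 0 < γ) (hγ1 : γ ≤ (min 𝔠.gamma0 1) ^ 2)
    (hTop : ∃ c : ℝ, 0 ≤ c ∧ ∀ (K j n : ℕ), j + n = K →
      (fieldMeasure (F.P K) j (Matrix.specialUnitaryGroup (Fin 2) ℂ)).map (iterFrom (avT3 F K) j n) ≤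
        ENNReal.ofReal (Real.exp c) • fieldMeasure (F.P K) (j + n) (Matrix.specialUnitaryGroup (Fin 2) ℂ)) :
    ∃ A₁ : ℝ, 0 ≤ A₁ ∧ ∀ (K : ℕ) (r : Hist (F.P K) K),
      ∀ᵐ W ∂(fieldMeasure (F.P K) K (Matrix.specialUnitaryGroup (Fin 2) ℂ)),
        (inputOfAC 𝔠.lane (h.pkgAt γ hγ hγ1 K).X (h.pkgAt γ hγ hγ1 K).𝔖).W.mass K r W ≤ ((K : ℝ) + 1) * Real.exp A₁ := by
  obtain ⟨c, hc0, hc⟩ := hTop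
  refine ⟨c, hc0, fun K r => ?_⟩
  have key := massRecAC_le_lin_exp_ae_of_map_iterFrom_le 𝔠.lane.carrier.M₁
    (rcolOf (T3Scales F γ hγ (hγ1.trans (sq_min_one_le _ 𝔠.gamma0_pos)) K) 𝔠.lane.carrier)
    (eps1Of (T3Scales F γ hγ (hγ1.trans (sq_min_one_le _ 𝔠.gamma0_pos)) K) 𝔠.lane.carrier)
    (epsSOf (T3Scales F γ hγ (hγ1.trans (sq_min_one_le _ 𝔠.gamma0_pos)) K) 𝔠.lane.carrier)
    (avT3 F K) (avgAC_avT3 F K) K c hc0 (fun j n hjn => hc K j n hjn) r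
  filter_upwards [key] with W hW
  exact hW

/-- ★★★ **THE LINEAR MASS ENVELOPE — K-21 §2's binder `hJ` VERBATIM (admissible non-trivial histories) — FROM THE TOP-LEVEL LETTER hTop**; with LEAD K-21
`AlphaInputsT3AC.Of.hSii_of_linMassEnvelope` the (S-ii) organ row `hSii` of `stub_pinnedStep` follows, so R-19936-S displays, beyond the (α) socket and `hMain`,
only hTop. [cite: Balaban1985UV3, (41) p.266 + (2) p.256 + (5) p.257; Balaban1985Averaging, (15) p.19] -/
theorem _root_.Summit.QuantumFields.YangMills.Theorems.AlphaInputsT3AC.Of.linMassEnvelope_of_topHaarPushforward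
    (h : AlphaInputsT3AC.Of F 𝔠) (γ : ℝ) (hγ : 0 < γ) (hγ1 : γ ≤ (min 𝔠.gamma0 1) ^ 2)
    (hTop : ∃ c : ℝ, 0 ≤ c ∧ ∀ (K j n : ℕ), j + n = K →
      (fieldMeasure (F.P K) j (Matrix.specialUnitaryGroup (Fin 2) ℂ)).map (iterFrom (avT3 F K) j n) ≤
        ENNReal.ofReal (Real.exp c) • fieldMeasure (F.P K) (j + n) (Matrix.specialUnitaryGroup (Fin 2) ℂ)) :
    ∃ A₁ : ℝ, ∀ (K : ℕ) (r : Hist (F.P K) K),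
      Hist.Admissible 𝔠.lane.carrier.M₁ (rcolOf (T3Scales F γ hγ (hγ1.trans (sq_min_one_le _ 𝔠.gamma0_pos)) K) 𝔠.lane.carrier) K r →
      r ≠ Hist.triv (F.P K) K →
      ∀ᵐ W ∂(fieldMeasure (F.P K) K (Matrix.specialUnitaryGroup (Fin 2) ℂ)),
        (inputOfAC 𝔠.lane (h.pkgAt γ hγ hγ1 K).X (h.pkgAt γ hγ hγ1 K).𝔖).W.mass K r W ≤ ((K : ℝ) + 1) * Real.exp A₁ := by
  obtain ⟨A₁, -, hA⟩ := h.linMassEnvelope_all_of_topHaarPushforward γ hγ hγ1 hTop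
  exact ⟨A₁, fun K r _ _ => hA K r⟩

/-- ★ **… in the `exp(A₁ + A₂·K)` reading** (the K-LINEARLY GROWING log-envelope hJ♭ of `ym-ust-19936-w5` g18's RELAX-hJ, with `A₂ = 1`): from hTop,
`m_K(r,·) ≤ exp(A₁ + 1·K)` a.e. for admissible non-trivial `r` (`K + 1 ≤ e^{K}`, `Real.add_one_le_exp`). [cite: Balaban1985UV3, (41) p.266 + (5) p.257 (bookkeeping)] -/
theorem _root_.Summit.QuantumFields.YangMills.Theorems.AlphaInputsT3AC.Of.growingMassEnvelope_of_topHaarPushforward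
    (h : AlphaInputsT3AC.Of F 𝔠) (γ : ℝ) (hγ : 0 < γ) (hγ1 : γ ≤ (min 𝔠.gamma0 1) ^ 2)
    (hTop : ∃ c : ℝ, 0 ≤ c ∧ ∀ (K j n : ℕ), j + n = K →
      (fieldMeasure (F.P K) j (Matrix.specialUnitaryGroup (Fin 2) ℂ)).map (iterFrom (avT3 F K) j n) ≤
        ENNReal.ofReal (Real.exp c) • fieldMeasure (F.P K) (j + n) (Matrix.specialUnitaryGroup (Fin 2) ℂ)) :
    ∃ A₁ A₂ : ℝ, ∀ (K : ℕ) (r : Hist (F.P K) K),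
      Hist.Admissible 𝔠.lane.carrier.M₁ (rcolOf (T3Scales F γ hγ (hγ1.trans (sq_min_one_le _ 𝔠.gamma0_pos)) K) 𝔠.lane.carrier) K r →
      r ≠ Hist.triv (F.P K) K →
      ∀ᵐ W ∂(fieldMeasure (F.P K) K (Matrix.specialUnitaryGroup (Fin 2) ℂ)),
        (inputOfAC 𝔠.lane (h.pkgAt γ hγ hγ1 K).X (h.pkgAt γ hγ hγ1 K).𝔖).W.mass K r W ≤ Real.exp (A₁ + A₂ * K) := by
  obtain ⟨A₁, hA⟩ := h.linMassEnvelope_of_topHaarPushforward γ hγ hγ1 hTop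
  refine ⟨A₁, 1, fun K r hadm hne => ?_⟩
  filter_upwards [hA K r hadm hne] with W hW
  have hK : (K : ℝ) + 1 ≤ Real.exp (K : ℝ) := Real.add_one_le_exp _
  have hE : 0 ≤ Real.exp A₁ := (Real.exp_pos _).le
  calc _ ≤ ((K : ℝ) + 1) * Real.exp A₁ := hW
    _ ≤ Real.exp (K : ℝ) * Real.exp A₁ := mul_le_mul_of_nonneg_right hK hE
    _ = Real.exp (A₁ + 1 * K) := by rw [one_mul, add_comm, Real.exp_add]

/-- **In range the composite of the pinned family IS the cruxes' iterated block averaging**: `iterFrom (avT3 F K) j n = iterFrom (fun i ↦ blockAvg ℰp) j n` for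
`j + n ≤ m + K` (✓`avT3_of_le` step by step). [cite: Balaban1987RG1, (0.4) + (0.11) p.253] -/
theorem iterFrom_avT3_eq_iterFrom_blockAvg (F : T3Family) (K j : ℕ) : ∀ n : ℕ, j + n ≤ F.m + K →
    iterFrom (avT3 F K) j n =
      iterFrom (fun i => BlockAveraging.blockAvg (P := F.P K) (G := Matrix.specialUnitaryGroup (Fin 2) ℂ) (j := i) ℰp) j n
  | 0, _ => rfl
  | n + 1, hn => by
    show (avT3 F K (j + n)).avg ∘ iterFrom (avT3 F K) j n =
      (BlockAveraging.blockAvg (P := F.P K) (G := Matrix.specialUnitaryGroup (Fin 2) ℂ) (j := j + n) ℰp).avg ∘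
        iterFrom (fun i => BlockAveraging.blockAvg (P := F.P K) (G := Matrix.specialUnitaryGroup (Fin 2) ℂ) (j := i) ℰp) j n
    rw [iterFrom_avT3_eq_iterFrom_blockAvg F K j n (by omega), avT3_of_le F K (show j + n + 1 ≤ F.m + K by omega)]

/-- ★ **THE SAME WITH THE CRUXES' `blockAvg ℰp` FAMILY SPELLED OUT**: if every segment `Ū_{K−1}∘⋯∘Ū_j` of the iterated block averaging `blockAvg ℰp` of the
run `K` ending at the unit torus pushes Haar to `≤ e^{c}`·Haar (ONE `c ≥ 0` per family), then `m_K(r,·) ≤ (K+1)·e^{c}` a.e. for admissible non-trivial `r`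
(`iterFrom_avT3_eq_iterFrom_blockAvg`, `j + n = K ≤ m + K`). [cite: Balaban1985UV3, (41) p.266 + (2) p.256 + (5) p.257; Balaban1987RG1, (0.4) + (0.11) p.253] -/
theorem _root_.Summit.QuantumFields.YangMills.Theorems.AlphaInputsT3AC.Of.linMassEnvelope_of_topBlockAvgPushforward
    (h : AlphaInputsT3AC.Of F 𝔠) (γ : ℝ) (hγ : 0 < γ) (hγ1 : γ ≤ (min 𝔠.gamma0 1) ^ 2)
    (hTopB : ∃ c : ℝ, 0 ≤ c ∧ ∀ (K j n : ℕ), j + n = K →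
      (fieldMeasure (F.P K) j (Matrix.specialUnitaryGroup (Fin 2) ℂ)).map
          (iterFrom (fun i => BlockAveraging.blockAvg (P := F.P K) (G := Matrix.specialUnitaryGroup (Fin 2) ℂ) (j := i) ℰp) j n) ≤
        ENNReal.ofReal (Real.exp c) • fieldMeasure (F.P K) (j + n) (Matrix.specialUnitaryGroup (Fin 2) ℂ)) :
    ∃ A₁ : ℝ, ∀ (K : ℕ) (r : Hist (F.P K) K),
      Hist.Admissible 𝔠.lane.carrier.M₁ (rcolOf (T3Scales F γ hγ (hγ1.trans (sq_min_one_le _ 𝔠.gamma0_pos)) K) 𝔠.lane.carrier) K r →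
      r ≠ Hist.triv (F.P K) K →
      ∀ᵐ W ∂(fieldMeasure (F.P K) K (Matrix.specialUnitaryGroup (Fin 2) ℂ)),
        (inputOfAC 𝔠.lane (h.pkgAt γ hγ hγ1 K).X (h.pkgAt γ hγ hγ1 K).𝔖).W.mass K r W ≤ ((K : ℝ) + 1) * Real.exp A₁ := by
  obtain ⟨c, hc0, hc⟩ := hTopB
  refine h.linMassEnvelope_of_topHaarPushforward γ hγ hγ1 ⟨c, hc0, fun K j n hjn => ?_⟩
  rw [iterFrom_avT3_eq_iterFrom_blockAvg F K j n (by omega)]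
  exact hc K j n hjn

/-- ★ **K-21's ALL-LEVELS LETTER (a)′∀ IMPLIES THE TOP-LEVEL LETTER hTop** (per family; `map_iterFrom_le_of_partialIterates_le` at the canonical partial
iterates of `avT3 F K`, target level `K`): every consumer of (a)′∀ is served by hTop, which asks nothing at the volume-growing levels `k < K`.
[cite: Balaban1985UV3, (2) p.256 (bookkeeping); Balaban1987RG1, (0.11) p.253] -/
theorem topHaarPushforward_of_partialIterates (F : T3Family)
    (hPI : ∃ c : ℝ, 0 ≤ c ∧ ∀ (K : ℕ) (ι : ∀ j k : ℕ, Measure (GaugeField (F.P K) k (Matrix.specialUnitaryGroup (Fin 2) ℂ))),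
      (∀ j, ι j j = fieldMeasure (F.P K) j (Matrix.specialUnitaryGroup (Fin 2) ℂ)) →
      (∀ j k, j ≤ k → ι j (k + 1) = (ι j k).map (avT3 F K k).avg) →
      ∀ j k, j < k → k ≤ K → ι j k ≤ ENNReal.ofReal (Real.exp c) • fieldMeasure (F.P K) k (Matrix.specialUnitaryGroup (Fin 2) ℂ)) :
    ∃ c : ℝ, 0 ≤ c ∧ ∀ (K j n : ℕ), j + n = K →
      (fieldMeasure (F.P K) j (Matrix.specialUnitaryGroup (Fin 2) ℂ)).map (iterFrom (avT3 F K) j n) ≤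
        ENNReal.ofReal (Real.exp c) • fieldMeasure (F.P K) (j + n) (Matrix.specialUnitaryGroup (Fin 2) ℂ) := by
  obtain ⟨c, hc0, hc⟩ := hPI
  refine ⟨c, hc0, fun K j n hjn => ?_⟩
  obtain ⟨ι, hι0, hιs⟩ := exists_partialIterates (avT3 F K)
  exact map_iterFrom_le_of_partialIterates_le (avT3 F K) (avgAC_avT3 F K) ι hι0 hιs K c hc0
    (fun j' k' hjk' hk'K => hc K ι hι0 hιs j' k' hjk' hk'K) j n hjn

end Lane

end Summit.QuantumFields.YangMills.Theorems.UV3PinnedStepOrganOfTopPartialIterates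

end
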